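import Summits.RiemannHypothesis.RiemannHypothesis.Theorems.Splittings.RobinFiniteOneFactPsiTheta
import Summits.RiemannHypothesis.RiemannHypothesis.Theorems.Splittings.RobinFiniteSqrtWindowBoxes
import HarnessLib

/-!
# RobinFiniteOneFactCore — the `c = 1` core and its windowed / pointwise / Platt–Trudgian consumers without BKLNW

Cell rh-split, seat rh-split-robin-finite g17 (brief sha16 f79c5f09d8bcb036), card `cards/SPLIT-robin-finite.md` §24; carved verbatim from the
kernel-checked object `HOME/rh-split-robin-finite/g17/SketchG17-OneFact.lean` (rc 0, 0 warnings, 0 sorries, standard axioms).  Zero `def`,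
zero `instance`, zero `notation`, no attribute changes, no `native_decide`.

GEN 17 «ONE PRINT FACT», part 2/3: the `c = 1` core WITHOUT BKLNW.  `corePwLower1B_of_stubs` is the tree's `RobinFiniteC1Core.corePwLower1_of_stubs`
verbatim with S4 replaced by the split `J − K` bound of part 1; the excess `8.9·10⁻²²` is paid by the `√`-coefficient slack `0.021·(2a₁ − 2a₂ + 8a₃)
≥ 0.035·a₁ ≥ 4.4·10⁻²¹` (`a₁ = 1/(√x log x)`, `599 ≤ x ≤ 10³⁴`), so `corePwLower1B hB` has the SAME conclusion and the SAME constant `0.0463` as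
`corePwLower1 hB hK`.  Consumers minus `hK`: `partialNicolasBetween1B_{holds,of_tail,tailFree}`, `negLog_le_Eb_pointB` (`B ≤ 10³⁴`); below `10¹⁹` the
window itself from Büthe 2018 + the kernel table (gen 16's `thetaWindow_ofB`, CITED FROM THE TREE — typer repair ixl-a), hence `negLog_le_Eb_point_one` from {Büthe 2018 Thm 2, RH(T)} ONLY; the
Platt–Trudgian trio `nicolasLowerBetween1_PT_B`, `…_tailFree_B`, `negLog_le_Eb1_PT_B` from {Büthe 2016 Thm 2, Büthe 2018 Thm 2, RH(3 000 175 332 800)}.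

HONEST LABEL: «SPLITTING SEARCH over kernel-typed RH-EQUIVALENCES; a splitting A ∧ B ⟹ RH is CONDITIONAL bookkeeping unless A and B
are both proved; nothing here bears on the truth of RH.»
-/

set_option linter.dupNamespace false

noncomputable section

open scoped Real Chebyshev ComplexConjugate

namespace Summit.RiemannHypothesis.RiemannHypothesis.Theorems.Splittings.RobinFiniteC1

open Literature.NumberTheory.LFunctions Literature.NumberTheory.DiophantineGeometry
open NicolasJ NicolasFz NicolasK NicolasJExplicit
open Summit.RiemannHypothesis.RiemannHypothesis.Theorems.Splittings.RobinFiniteE1c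
open Summit.RiemannHypothesis.RiemannHypothesis.Theorems.Splittings.RobinFiniteE3

section OneFact

open Complex Filter Set MeasureTheory Topology intervalIntegral

/-! ### O3 · the `c = 1` core WITHOUT BKLNW: same three-stub bookkeeping, same constant `0.0463`, `x ≤ 10³⁴` -/

/-- `log x ≤ 78.33` for `0 < x ≤ 10³⁴` (`10³⁴ ≤ 2¹¹³`, `113·log 2 ≤ 78.33`). -/
theorem log_le_of_le_1e34 {x : ℝ} (hx0 : 0 < x) (hx34 : x ≤ 1e34) : Real.log x ≤ 78.33 := by
  have h2 := Real.log_two_lt_d9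
  have h113 : Real.log ((2 : ℝ) ^ 113) = 113 * Real.log 2 := by
    rw [Real.log_pow]; norm_num
  calc Real.log x ≤ Real.log ((2 : ℝ) ^ 113) := Real.log_le_log hx0 (hx34.trans (by norm_num))
    _ = 113 * Real.log 2 := h113
    _ ≤ 78.33 := by linarith

/-- `6 ≤ log x` for `x ≥ 599` (`e⁶ ≤ 2.7182818286⁶ ≤ 404 ≤ 599`).  (The Li family has the same fact for `x ≥ 404` as
`LiTheory.BudgetLog.six_le_log` in `LiHeightLogLiHeightBudgetLogBound`; not imported, to keep the Robin chain free of Li-route modules.) -/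
theorem six_le_log_599 {x : ℝ} (hx : 599 ≤ x) : (6 : ℝ) ≤ Real.log x := by
  rw [Real.le_log_iff_exp_le (by linarith)]
  have e : Real.exp 6 = Real.exp 1 ^ 6 := by rw [← Real.exp_nat_mul]; norm_num
  rw [e]
  exact ((pow_le_pow_left₀ (Real.exp_pos 1).le Real.exp_one_lt_d9.le 6).trans (by norm_num)).trans hx

/-- c = 1 · **the E1c⁻ core from the SAME stubs h1, h2 as the tree's `corePwLower1_of_stubs`, with S4 replaced by the SPLIT `J − K` bound**
`hJ : ∫_x^X (ψ − t)w₀ − ∫_x^X (θ − t)w₀ ≤ F_{1/2}(x) + (4/3)F_{1/3}(x) + 8.9·10⁻²²` (`599 ≤ x ≤ 10³⁴`, `X ≥ x`): the SAME conclusion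
`−log f(x) ≤ E(0.0463 + (1 + 2/log x)D, x)` for `599 ≤ x ≤ 10³⁴`.  Proof = the tree's verbatim, plus the one inequality
`8.9·10⁻²² ≤ 0.021·(2a₁ − 2a₂ + 8a₃)` (`a₂ ≤ a₁/6`, `a₁ ≥ 1/(10¹⁷·78.33) ≥ 1.27·10⁻¹⁹`; any cap with `√x·log x ≤ 3.9·10¹⁹` would do). -/
theorem corePwLower1B_of_stubs
    (h1 : ∀ x : ℝ, 1 < x →
      Summable (fun ρ : Zeros ↦ (riemannZetaZeroOrder (ρ : ℂ) : ℂ) / (ρ : ℂ) * Fz (ρ : ℂ) x) ∧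
      ∃ L : ℝ, Tendsto (fun X : ℝ ↦ ∫ t in x..X, (ψ t - t) * w0 t) atTop (𝓝 L) ∧
        (-∑' ρ : Zeros, (riemannZetaZeroOrder (ρ : ℂ) : ℂ) / (ρ : ℂ) * Fz (ρ : ℂ) x).re
          - Real.log (2 * π) / (x * Real.log x) ≤ L)
    (h2 : ∀ T x D : ℝ, 1 < x → RiemannHypothesisUpTo T →
      (∑' ρ : RHWave0.riemannZetaNontrivialZeros,
        (if T < |(ρ : ℂ).im| then
          (riemannZetaZeroOrder (ρ : ℂ) : ℝ) * x ^ ((ρ : ℂ).re - 1 / 2) / (ρ : ℂ).im ^ 2 else 0) ≤ D) →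
      Summable (fun ρ : Zeros ↦ (riemannZetaZeroOrder (ρ : ℂ) : ℂ) / (ρ : ℂ) * Fz (ρ : ℂ) x) →
        -(0.0463 * (1 / (Real.sqrt x * Real.log x) + Dx x)
            + (1 + 2 / Real.log x) * D * (1 / (Real.sqrt x * Real.log x))) ≤
          (-∑' ρ : Zeros, (riemannZetaZeroOrder (ρ : ℂ) : ℂ) / (ρ : ℂ) * Fz (ρ : ℂ) x).re)
    (hJ : ∀ x X : ℝ, 599 ≤ x → x ≤ 1e34 → x ≤ X →
      (∫ t in x..X, (ψ t - t) * w0 t) - ∫ t in x..X, (θ t - t) * w0 t ≤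
        (Fz (1 / 2 : ℝ) x).re + 4 / 3 * (Fz (1 / 3 : ℝ) x).re + 8.9e-22) :
    ∀ T x D : ℝ, 599 ≤ x → x ≤ 1e34 → 0 ≤ D → RiemannHypothesisUpTo T →
      (∀ y : ℝ, 599 ≤ y → y ≤ x → |θ y - y| ≤ √y * Real.log y ^ 2 / (8 * π)) →
      (∑' ρ : RHWave0.riemannZetaNontrivialZeros,
        (if T < |(ρ : ℂ).im| then
          (riemannZetaZeroOrder (ρ : ℂ) : ℝ) * x ^ ((ρ : ℂ).re - 1 / 2) / (ρ : ℂ).im ^ 2 else 0) ≤ D) →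
      -Real.log (nicolasF x) ≤ RobinAnalyticSharp.nicolasERH x +
        (0.0463 + (1 + 2 / Real.log x) * D - nicolasBeta) *
          (1 / (√x * Real.log x) + 1 / (√x * Real.log x ^ 2) + 4 / (√x * Real.log x ^ 3)) := by
  intro T x D hx hx34 hD hT hW hoff
  have hx1 : (1 : ℝ) < x := by linarith
  have hx0 : (0 : ℝ) < x := by linarith
  have hlx : 0 < Real.log x := Real.log_pos hx1
  have hsx : 0 < Real.sqrt x := Real.sqrt_pos.2 hx0
  have h21 := NicolasK.lemma21_lower (by linarith : (121 : ℝ) ≤ x) (theta_ge_four_fifths_of_window hW hx)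
  have hS2 := sq_theta_sub_div_le_of_window hW hx
  obtain ⟨hsum, L, hL, hZL⟩ := h1 x hx1
  have hK := NicolasK.tendsto_integral_S_mul_w0 hx1
  have hJK : L - nicolasKInt x ≤ (Fz (1 / 2 : ℝ) x).re + 4 / 3 * (Fz (1 / 3 : ℝ) x).re + 8.9e-22 := by
    refine le_of_tendsto (hL.sub hK) ?_
    filter_upwards [eventually_ge_atTop x] with X hX
    exact hJ x X hx hx34 hX
  have hZ := h2 T x D hx1 hT hoff hsum
  have hF2 := NicolasFz.Fhalf_le hx1
  have hF3 := NicolasFz.Fthird_le hx1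
  obtain ⟨a₁, ha₁⟩ : ∃ a : ℝ, a = 1 / (Real.sqrt x * Real.log x) := ⟨_, rfl⟩
  obtain ⟨a₂, ha₂⟩ : ∃ a : ℝ, a = 1 / (Real.sqrt x * Real.log x ^ 2) := ⟨_, rfl⟩
  obtain ⟨a₃, ha₃⟩ : ∃ a : ℝ, a = 1 / (Real.sqrt x * Real.log x ^ 3) := ⟨_, rfl⟩
  obtain ⟨a₅, ha₅⟩ : ∃ a : ℝ, a = 1 / (x ^ ((2 : ℝ) / 3) * Real.log x) := ⟨_, rfl⟩
  obtain ⟨P, hP⟩ : ∃ a : ℝ, a = (1 + 2 / Real.log x) * D := ⟨_, rfl⟩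
  have hP0 : 0 ≤ P := by rw [hP]; positivity
  have ha₁0 : 0 ≤ a₁ := by rw [ha₁]; positivity
  have ha₂0 : 0 ≤ a₂ := by rw [ha₂]; positivity
  have ha₃0 : 0 ≤ a₃ := by rw [ha₃]; positivity
  have hPa₁ : 0 ≤ P * a₁ := mul_nonneg hP0 ha₁0
  have hPa₂ : 0 ≤ P * a₂ := mul_nonneg hP0 ha₂0
  have hPa₃ : 0 ≤ P * a₃ := mul_nonneg hP0 ha₃0
  -- NEW (gen 17): the absolute excess `8.9e-22` is paid by `0.021·(2a₁ − 2a₂ + 8a₃)` on `599 ≤ x ≤ 10³⁴`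
  have hL6 := six_le_log_599 hx
  have hL78 := log_le_of_le_1e34 hx0 hx34
  have hs17 : Real.sqrt x ≤ 1e17 :=
    calc Real.sqrt x ≤ Real.sqrt ((1e17 : ℝ) ^ 2) := Real.sqrt_le_sqrt (hx34.trans (by norm_num))
      _ = 1e17 := Real.sqrt_sq (by norm_num)
  have ha₁lo : (1.27e-19 : ℝ) ≤ a₁ := by
    rw [ha₁]
    refine le_trans (by norm_num : (1.27e-19 : ℝ) ≤ 1 / (1e17 * 78.33)) ?_
    exact one_div_le_one_div_of_le (by positivity) (mul_le_mul hs17 hL78 hlx.le (by norm_num))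
  have ha₂a₁ : 6 * a₂ ≤ a₁ := by
    have e : a₂ * Real.log x = a₁ := by
      rw [ha₁, ha₂]; field_simp
    calc 6 * a₂ = a₂ * 6 := by ring
      _ ≤ a₂ * Real.log x := mul_le_mul_of_nonneg_left hL6 ha₂0
      _ = a₁ := e
  have hExcess : (8.9e-22 : ℝ) ≤ 0.021 * (2 * a₁ - 2 * a₂ + 8 * a₃) := by nlinarith
  have eZ : -(0.0463 * (1 / (Real.sqrt x * Real.log x) + Dx x)
      + (1 + 2 / Real.log x) * D * (1 / (Real.sqrt x * Real.log x))) =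
      -0.0463 * a₁ - 0.0463 * a₂ - 0.1852 * a₃ - P * a₁ := by
    rw [ha₁, ha₂, ha₃, hP, NicolasJExplicit.Dx]
    field_simp
    ring
  have eF2 : 2 / (Real.sqrt x * Real.log x) - 2 / (Real.sqrt x * Real.log x ^ 2) +
      8 / (Real.sqrt x * Real.log x ^ 3) = 2 * a₁ - 2 * a₂ + 8 * a₃ := by
    rw [ha₁, ha₂, ha₃]; ring
  have eF3 : 3 / (2 * x ^ (2 / 3 : ℝ) * Real.log x) = 3 / 2 * a₅ := by
    rw [ha₅]; ring
  have eE : RobinAnalyticSharp.nicolasERH x +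
        (0.0463 + (1 + 2 / Real.log x) * D - nicolasBeta) *
          (1 / (√x * Real.log x) + 1 / (√x * Real.log x ^ 2) + 4 / (√x * Real.log x ^ 3)) =
      2.0883 * a₁ + (P * a₁) - 1.9957 * a₂ + (P * a₂) + 8.3532 * a₃ + 4 * (P * a₃)
        + Real.log (2 * π) / (x * Real.log x) + 2 * a₅ + Real.log x ^ 3 / (64 * π ^ 2 * x) := by
    rw [ha₁, ha₂, ha₃, ha₅, hP]
    unfold RobinAnalyticSharp.nicolasERH RobinAnalyticSharp.nicolasE
    ring
  rw [eZ] at hZ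
  rw [eF2] at hF2
  rw [eF3] at hF3
  rw [eE]
  linarith

/-- c = 1 · **THE CORE MODULO ONE RH-FREE PRINT FACT** (Büthe 2018 Thm 2, hypothesis position): for `599 ≤ x ≤ 10³⁴`, `D ≥ 0`, RH up to `T`,
Schoenfeld's `θ`-window on `[599, x]` and `Σ_{|γ|>T} m(ρ) x^{Re ρ − 1/2}/γ² ≤ D`: `−log f(x) ≤ E(0.0463 + (1 + 2/log x)D, x)` — the tree's
`corePwLower1 hB hK` with `hK` (BKLNW 2021) GONE and nothing else changed. -/
theorem corePwLower1B (hB : Buthe2018_thm2_theta) :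
    ∀ T x D : ℝ, 599 ≤ x → x ≤ 1e34 → 0 ≤ D → RiemannHypothesisUpTo T →
      (∀ y : ℝ, 599 ≤ y → y ≤ x → |θ y - y| ≤ √y * Real.log y ^ 2 / (8 * π)) →
      (∑' ρ : RHWave0.riemannZetaNontrivialZeros,
        (if T < |(ρ : ℂ).im| then
          (riemannZetaZeroOrder (ρ : ℂ) : ℝ) * x ^ ((ρ : ℂ).re - 1 / 2) / (ρ : ℂ).im ^ 2 else 0) ≤ D) →
      -Real.log (nicolasF x) ≤ RobinAnalyticSharp.nicolasERH x +
        (0.0463 + (1 + 2 / Real.log x) * D - nicolasBeta) *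
          (1 / (√x * Real.log x) + 1 / (√x * Real.log x ^ 2) + 4 / (√x * Real.log x ^ 3)) :=
  corePwLower1B_of_stubs explicitFormulaFree_holds zeroSplitBound_holds
    fun x X hx hx34 hX ↦ jk_partial_le_ofB hB (by linarith) (hx34.trans (by norm_num)) hX

/-! ### O4 · the windowed and pointwise consumers without BKLNW (`B ≤ 10³⁴`) -/

/-- c = 1 · **E1c⁻ ⟹ windowed E1 without BKLNW**: the tree's `partialNicolasBetween1_holds` with `hK` dropped, on windows `[X₀, X₁] ⊆ [599, B]`,
`B ≤ 10³⁴`. -/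
theorem partialNicolasBetween1B_holds (hB : Buthe2018_thm2_theta) {T B D X₀ X₁ : ℝ}
    (hoff : ∀ x : ℝ, X₀ ≤ x → x ≤ X₁ →
      ∑' ρ : RHWave0.riemannZetaNontrivialZeros,
        (if T < |(ρ : ℂ).im| then
          (riemannZetaZeroOrder (ρ : ℂ) : ℝ) * x ^ ((ρ : ℂ).re - 1 / 2) / (ρ : ℂ).im ^ 2 else 0) ≤ D)
    (hD : 0 ≤ D) (hX₀ : 1 < X₀) (hBB : X₁ ≤ B) (hB34 : B ≤ 1e34) :
    RiemannHypothesisUpTo T → (∀ y : ℝ, 599 ≤ y → y ≤ B → |θ y - y| ≤ √y * Real.log y ^ 2 / (8 * π)) →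
      ∀ x : ℝ, 599 ≤ x → X₀ ≤ x → x ≤ X₁ →
        -Real.log (nicolasF x) ≤ RobinAnalyticSharp.nicolasERH x +
            (0.0463 + (1 + 2 / Real.log X₀) * D - nicolasBeta) *
              (1 / (√x * Real.log x) + 1 / (√x * Real.log x ^ 2) + 4 / (√x * Real.log x ^ 3)) := by
  intro hT hθ x hx hx0 hx1
  have h := corePwLower1B hB T x D hx (hx1.trans (hBB.trans hB34)) hD hT
    (fun y hy hyx => hθ y hy (le_trans hyx (le_trans hx1 hBB))) (hoff x hx0 hx1)
  exact h.trans (nicolasEWith_mono (by linarith) (budgetPw1_anti hD hX₀ hx0))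

/-- c = 1 · **E1c⁻ ∧ (tail bound) ⟹ windowed E1 without BKLNW** (`partialNicolasBetween1_of_tail` minus `hK`; `B ≤ 10³⁴`). -/
theorem partialNicolasBetween1B_of_tail (hB : Buthe2018_thm2_theta) {T B h X₀ X₁ : ℝ}
    (ht : ∑' ρ : RHWave0.riemannZetaNontrivialZeros,
        (if T < |(ρ : ℂ).im| then (riemannZetaZeroOrder (ρ : ℂ) : ℝ) / (ρ : ℂ).im ^ 2 else 0) ≤ h)
    (hh : 0 ≤ h) (hX₀ : 1 < X₀) (hBB : X₁ ≤ B) (hB34 : B ≤ 1e34) :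
    RiemannHypothesisUpTo T → (∀ y : ℝ, 599 ≤ y → y ≤ B → |θ y - y| ≤ √y * Real.log y ^ 2 / (8 * π)) →
      ∀ x : ℝ, 599 ≤ x → X₀ ≤ x → x ≤ X₁ →
        -Real.log (nicolasF x) ≤ RobinAnalyticSharp.nicolasERH x +
            (0.0463 + (1 + 2 / Real.log X₀) * (h * √X₁) - nicolasBeta) *
              (1 / (√x * Real.log x) + 1 / (√x * Real.log x ^ 2) + 4 / (√x * Real.log x ^ 3)) := by
  refine partialNicolasBetween1B_holds hB (fun x hx0 hx1 => ?_) (by positivity) hX₀ hBB hB34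
  have hx1' : 1 ≤ x := by linarith
  exact le_trans (offLineSumAt_of_zeroTailBound ht hx1')
    (mul_le_mul_of_nonneg_left (Real.sqrt_le_sqrt hx1) hh)

/-- c = 1 · **the kernel-priced tail at ANY height `T ≥ 7` without BKLNW** (`partialNicolasBetween1_tailFree` minus `hK`; `B ≤ 10³⁴`):
budget `0.0463 + (1 + 2/log X₀)·tailH(T)·√X₁`. -/
theorem partialNicolasBetween1B_tailFree (hB : Buthe2018_thm2_theta) {T B X₀ X₁ : ℝ} (hT : 7 ≤ T) (hX₀ : 1 < X₀)
    (hBB : X₁ ≤ B) (hB34 : B ≤ 1e34) :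
    RiemannHypothesisUpTo T → (∀ y : ℝ, 599 ≤ y → y ≤ B → |θ y - y| ≤ √y * Real.log y ^ 2 / (8 * π)) →
      ∀ x : ℝ, 599 ≤ x → X₀ ≤ x → x ≤ X₁ →
        -Real.log (nicolasF x) ≤ RobinAnalyticSharp.nicolasERH x +
            (0.0463 + (1 + 2 / Real.log X₀) *
              (((Real.log (T / (2 * π)) + 1) / (π * T) + (184 + 30 * Real.log T) / T ^ 2) * √X₁) - nicolasBeta) *
              (1 / (√x * Real.log x) + 1 / (√x * Real.log x ^ 2) + 4 / (√x * Real.log x ^ 3)) :=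
  partialNicolasBetween1B_of_tail hB
    (Summit.RiemannHypothesis.RiemannHypothesis.Theorems.Splittings.RobinFiniteTail.zeroTailBound_tailH hT)
    (Summit.RiemannHypothesis.RiemannHypothesis.Theorems.Splittings.RobinFiniteTail.tailH_nonneg hT) hX₀ hBB hB34

/-- **The pointwise lower bound at height `T` without BKLNW** (`RobinFiniteLowHeightInputs.negLog_le_Eb_point` minus `hK`): RH to height
`T ≥ 7`, the `θ`-window on `[599, B]`, `599 ≤ P ≤ B ≤ 10³⁴` give `−log f(P) ≤ Eb(0.0463 + (1 + 2/log P)·tailH(T)·√P)(P)`. -/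
theorem negLog_le_Eb_pointB (hB : Buthe2018_thm2_theta) {T B P : ℝ} (hT : 7 ≤ T) (hRH : RiemannHypothesisUpTo T)
    (hW : ∀ y : ℝ, 599 ≤ y → y ≤ B → |θ y - y| ≤ √y * Real.log y ^ 2 / (8 * π))
    (hP : 599 ≤ P) (hPB : P ≤ B) (hB34 : B ≤ 1e34) :
    -Real.log (nicolasF P) ≤ RobinAnalyticSharp.nicolasERH P +
        (0.0463 + (1 + 2 / Real.log P) *
          (((Real.log (T / (2 * π)) + 1) / (π * T) + (184 + 30 * Real.log T) / T ^ 2) * √P) - nicolasBeta) *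
          (1 / (√P * Real.log P) + 1 / (√P * Real.log P ^ 2) + 4 / (√P * Real.log P ^ 3)) :=
  partialNicolasBetween1B_tailFree hB (X₀ := P) (X₁ := P) hT (by linarith) hPB hB34 hRH hW P hP le_rfl le_rfl

/-- **HEADLINE O4 · Nicolas's pointwise lower bound at ANY verification height from ONE print fact.**  RH to height `T ≥ 7` and Büthe 2018
Thm 2 give, for every `599 ≤ P ≤ 10¹⁹`, `−log f(P) ≤ Eb(0.0463 + (1 + 2/log P)·tailH(T)·√P)(P)` — the input of every low-height
Mertens / Robin row (`mertensProdLt_level`, `mertens_of_ramp`, gen 16's `mertensProdLt_levelS`), now with NO Büthe 2016, NO BKLNW 2021 and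
NO range condition `4.92√(B/log B) ≤ T`.  Nothing here bears on the truth of RH. -/
theorem negLog_le_Eb_point_one (hB : Buthe2018_thm2_theta) {T P : ℝ} (hT : 7 ≤ T) (hRH : RiemannHypothesisUpTo T)
    (hP : 599 ≤ P) (hP19 : P ≤ (10 : ℝ) ^ 19) :
    -Real.log (nicolasF P) ≤ RobinAnalyticSharp.nicolasERH P +
        (0.0463 + (1 + 2 / Real.log P) *
          (((Real.log (T / (2 * π)) + 1) / (π * T) + (184 + 30 * Real.log T) / T ^ 2) * √P) - nicolasBeta) *
          (1 / (√P * Real.log P) + 1 / (√P * Real.log P ^ 2) + 4 / (√P * Real.log P ^ 3)) :=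
  negLog_le_Eb_pointB hB hT hRH (thetaWindow_ofB hB) hP hP19 (by norm_num)

/-! ### O5 · the Platt–Trudgian chain from {Büthe 2016 Thm 2, Büthe 2018 Thm 2, RH(3 000 175 332 800)} — BKLNW gone -/

/-- c = 1 · **E1 ∧ E2 at the Platt–Trudgian height without BKLNW** (`nicolasLowerBetween1_PT` minus `hK`; `2.169·10²⁵ ≤ 10³⁴`). -/
theorem nicolasLowerBetween1_PT_B (h16 : Buthe2016_thm2) (hB : Buthe2018_thm2_theta)
    (hRH : RiemannHypothesisUpTo 3000175332800) {h X₀ X₁ : ℝ}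
    (ht : ∑' ρ : RHWave0.riemannZetaNontrivialZeros,
        (if 3000175332800 < |(ρ : ℂ).im| then (riemannZetaZeroOrder (ρ : ℂ) : ℝ) / (ρ : ℂ).im ^ 2 else 0) ≤ h)
    (hh : 0 ≤ h) (hX₀ : 1 < X₀) (hX₁ : X₁ ≤ 2.169e25) :
    ∀ x : ℝ, 599 ≤ x → X₀ ≤ x → x ≤ X₁ →
      -Real.log (nicolasF x) ≤ RobinAnalyticSharp.nicolasERH x +
          (0.0463 + (1 + 2 / Real.log X₀) * (h * √X₁) - nicolasBeta) *
            (1 / (√x * Real.log x) + 1 / (√x * Real.log x ^ 2) + 4 / (√x * Real.log x ^ 3)) :=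
  partialNicolasBetween1B_of_tail hB ht hh hX₀ hX₁ (by norm_num) hRH (schoenfeldThetaOn_of_buthe2016 h16 hRH le_rfl)

/-- c = 1 · **the book's E1 ∧ E2 at the Platt–Trudgian height with no tail hypothesis and no BKLNW** (`nicolasLowerBetween1_PT_tailFree` minus
`hK`): budget `0.0463 + (1 + 2/log X₀)·2.961·10⁻¹²·√X₁` on `[X₀, X₁]`, `X₁ ≤ 2.169·10²⁵`. -/
theorem nicolasLowerBetween1_PT_tailFree_B (h16 : Buthe2016_thm2) (hB : Buthe2018_thm2_theta)
    (hRH : RiemannHypothesisUpTo 3000175332800) {X₀ X₁ : ℝ} (hX₀ : 1 < X₀) (hX₁ : X₁ ≤ 2.169e25) :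
    ∀ x : ℝ, 599 ≤ x → X₀ ≤ x → x ≤ X₁ →
      -Real.log (nicolasF x) ≤ RobinAnalyticSharp.nicolasERH x +
          (0.0463 + (1 + 2 / Real.log X₀) * (2.961e-12 * √X₁) - nicolasBeta) *
            (1 / (√x * Real.log x) + 1 / (√x * Real.log x ^ 2) + 4 / (√x * Real.log x ^ 3)) :=
  nicolasLowerBetween1_PT_B h16 hB hRH (h := 2.961e-12)
    Summit.RiemannHypothesis.RiemannHypothesis.Theorems.Splittings.RobinFiniteTail.zeroTailBound_PT (by norm_num) hX₀ hX₁

/-- c = 1 · the same in the E3 shape (`RobinFiniteC1Main.negLog_le_Eb1_PT` minus `hK`). -/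
theorem negLog_le_Eb1_PT_B (h16 : Buthe2016_thm2) (hB : Buthe2018_thm2_theta)
    (hRH : RiemannHypothesisUpTo 3000175332800) {X₀ X₁ : ℝ} (hX₀ : 1 < X₀) (hX₁ : X₁ ≤ 2.169e25) {x : ℝ}
    (hx : 599 ≤ x) (h0 : X₀ ≤ x) (h1 : x ≤ X₁) :
    -Real.log (nicolasF x) ≤ (RobinAnalyticSharp.nicolasERH x + ((0.0463 + (1 + 2 / Real.log X₀) * (2.961e-12 * √X₁)) - nicolasBeta) *
      (1 / (√x * Real.log x) + 1 / (√x * Real.log x ^ 2) + 4 / (√x * Real.log x ^ 3))) :=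
  nicolasLowerBetween1_PT_tailFree_B h16 hB hRH hX₀ hX₁ x hx h0 h1

end OneFact

/-- info: 'Summit.RiemannHypothesis.RiemannHypothesis.Theorems.Splittings.RobinFiniteC1.corePwLower1B' depends on axioms: [propext, Classical.choice, Quot.sound] -/
#guard_msgs (whitespace := lax) in
#print axioms Summit.RiemannHypothesis.RiemannHypothesis.Theorems.Splittings.RobinFiniteC1.corePwLower1B

/-- info: 'Summit.RiemannHypothesis.RiemannHypothesis.Theorems.Splittings.RobinFiniteC1.negLog_le_Eb_point_one' depends on axioms: [propext, Classical.choice, Quot.sound] -/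
#guard_msgs (whitespace := lax) in
#print axioms Summit.RiemannHypothesis.RiemannHypothesis.Theorems.Splittings.RobinFiniteC1.negLog_le_Eb_point_one

/-- info: 'Summit.RiemannHypothesis.RiemannHypothesis.Theorems.Splittings.RobinFiniteC1.nicolasLowerBetween1_PT_tailFree_B' depends on axioms: [propext, Classical.choice, Quot.sound] -/
#guard_msgs (whitespace := lax) in
#print axioms Summit.RiemannHypothesis.RiemannHypothesis.Theorems.Splittings.RobinFiniteC1.nicolasLowerBetween1_PT_tailFree_B

end Summit.RiemannHypothesis.RiemannHypothesis.Theorems.Splittings.RobinFiniteC1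

end
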